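import Summits.ABC.IUTFork.Thm311MultiradProofs
import Summits.ABC.IUTFork.Thm311Real2
import HarnessLib

/-!
# [IUTchIII] Corollary 3.12, statement — the VERBATIM mono-analytic container (direct product regions over the
# direct SUMMANDS, normalized weighted log-volumes) and its (Ind1)/(Ind2)-invariance

Record-only file (D-0012) of the abc-iut cell (Cor. 3.12 sub-crew, seat abc-iut-c312-5, gen 2; D-0067 TEAM A row
A-0 «finiteness + BridgeHyps at the real setting»); TAKES NO SIDE. Seat c312-7's `Cor312.Setting` states
[IUTchIII] Cor. 3.12 (kurims `paper:url-4b091feeb646` p. 173 l. 41 – p. 174 l. 19) over c312-1's `Thm311.Situation`,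
whose data (a) of Thm. 3.11 (i) carry the admissible regions `𝕄(−)` and the mono-analytic log-volume `μ^log` as
BINDERS (`MRData.Adm`/`logvol`; c312-5's `Situation.ofShells`/`Real.situation`). This file supplies the two
binders VERBATIM from [IUTchIII] Rmk. 3.1.1 (ii)–(iv), READ ON THE PAGE: p. 95 l. 20–31 "let us refer to such a
region that arises as a direct product of compact subsets of positive measure in each of the direct summands as a
*direct product region*", where (p. 95 l. 40 – p. 96 l. 8) "the finite set '`V`' is taken to be the direct product
`Π_{α∈A} 𝕍_{v_ℚ}`" and "'`M_v`' is taken to be the [radial, if `v_ℚ ∈ 𝕍_ℚ^arc`] portion of the direct summand …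
that corresponds to the tensor product of the `{K_{v_α}}_{α∈A}`" — so the product is over the SUMMANDS `v⃗` of
`𝓘^ℚ(^{S^±_{j+1}};𝒟^⊢_{v_ℚ}) ≅ ⊕_{v⃗} ⊗_α K_{v_α}` and inside a summand ANY compact positive-measure subset is allowed
(`SummandPieces.Adm`); p. 94 (ii) third display (the normalized weight of `v⃗`, abc-iut-L6-t4
`packetWeightTensor`) with p. 96 l. 14–18 / Prop. 3.9 (i) p. 115: `Σ_{v⃗} w_{v⃗}·log μ_{v⃗}(A_{v⃗})` (abc-iut-L6-t4
`packetLogVolume`; `SummandPieces.logvol`). The summands with their admissibility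
predicate and log-measure are DATA (c312-3's real prime packets `PacketAlgebra p (k∘v⃗)`, `PacketAdm`, `packetLogμ`
at finite primes — companion `Cor312VolumesPadicSummands`; radial archimedean summands), with a SURJECTIVE
comparison `e : 𝓘^ℚ(−) → Π_{v⃗} M_{v⃗}` (campaign-S `piTensorDistrib`, Prop. 3.1 (i)).

PROVED (bookkeeping, [folklore]): §1 hull-type regions `e⁻¹(Π_{v⃗} H_{v⃗})` admissible with log-volume `Σ w·logμ(H)`,
`logvol` monotone on admissible regions, admissible ⇒ nonempty. §2 a packet automorphism `Φ` intertwined by `e`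
(`e∘Φ = Ψ∘e`) with a self-map `Ψ` of `Π M_{v⃗}` carrying direct product regions to direct product regions of the
same weighted log-volume (`PreservesRegions` — (Ind2): summandwise measure-preserving bijections, Dupuy–Hilado
§4.9 footnote; (Ind1): a permutation of the summands with measure-preserving identifications and symmetric
weights, Prop. 3.9 (i) p. 116) preserves `Adm` both ways and `logvol`; from c312-1's generators (`permute`,
`factorwise∘summandwise`) B's named Prop `MRData.LogvolInvariant` plus admissibility transport, and by
abc-iut-L6-t13's `adm_and_logvol_eq_of_mem_closure` invariance along the WHOLE indeterminacy subgroup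
(`adm_and_logvol_eq_of_mem_indGroup`). The consequences for c312-6's `BridgeHyps` of a `Cor312.Setting`
(`image_adm`, `image_fin`, `theta_nonempty`, `mono` discharged) are the companion `Cor312VolumesSummandsBridge`.

DESIGN NOTE: c312-6's `Cor312VolumesReal.VolumePieces` takes boxes over the FIELD FACTORS `L_i` of
`⊗_α K_{v_α} ≅ Π_i L_i` (finer than print); (Ind2) generators `⊗_α g_α` are not multiplicative and move such boxes off
boxes, so `image_adm` is not derivable there; both containers agree on hull-sets. [claim: Mochizuki2012, status:
disputed] for the quoted definitions. Deliberately NOT here: concrete summands, Θ-boxes, `ThetaFinite`, judgement.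
-/

noncomputable section

open Set Function

namespace Summit.ABC

namespace IUTFork

namespace Cor312Vol

open Thm311 Literature.IUT.LogThetaLattice Literature.IUT.LogVolume

variable {T : ThetaIndex}

/-! ## 1. Summand pieces: the verbatim `𝕄(−)` and `μ^log` of [IUTchIII] Rmk. 3.1.1 (ii)(iii) -/

/-- **SUMMAND PIECES** over c312-1's log-shell signature `L`: per packet `(j, v_ℚ)` the finite set of direct
SUMMANDS `v⃗ ∈ Π_{α∈S^±_{j+1}} 𝕍_{v_ℚ}` (Rmk. 3.1.1 (iii) p. 95: "the finite set '`V`' is taken to be the direct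
product `Π_{α∈A} 𝕍_{v_ℚ}`"), the summand "measure spaces" `M_{v⃗}` ("the direct summand … that corresponds to the
tensor product of the `{K_{v_α}}`", p. 96) given with their admissibility predicate ("compact subsets of positive
measure") and log-measure, a SURJECTIVE comparison `e` from the algebraic packet (Prop. 3.1 (i): the packet is
an inductive limit of such direct sums), and the nonnegative normalized weights (Rmk. 3.1.1 (ii) p. 94).
Data only; no claim. [claim: Mochizuki2012, status: disputed] -/
structure SummandPieces (L : LogShells T) : Type 1 where
  /-- the summand index `V = Π_α 𝕍_{v_ℚ}` at `(j, v_ℚ)` -/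
  E : T.Label → T.VQ → Type
  /-- … is finite -/
  [instFintype : ∀ j vQ, Fintype (E j vQ)]
  /-- the summand `M_{v⃗}` (underlying set of the measure space) -/
  X : ∀ j vQ, E j vQ → Type
  /-- "compact subsets of positive measure" of the summand `M_{v⃗}` -/
  adm : ∀ j vQ (e : E j vQ), Set (X j vQ e) → Prop
  /-- the log-measure `log μ_{v⃗}(−)` of the summand -/
  logμ : ∀ j vQ (e : E j vQ), Set (X j vQ e) → ℝ
  /-- a set of positive measure is nonempty -/
  adm_nonempty : ∀ j vQ e (R : Set (X j vQ e)), adm j vQ e R → R.Nonempty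
  /-- the log-measure is monotone on admissible sets -/
  logμ_mono : ∀ j vQ e (R R' : Set (X j vQ e)), adm j vQ e R → adm j vQ e R' → R ⊆ R' →
    logμ j vQ e R ≤ logμ j vQ e R'
  /-- the comparison map algebraic packet → direct sum of the summands ([IUTchIII] Prop. 3.1 (i)) -/
  e : ∀ j vQ, L.Packet j vQ → ∀ e : E j vQ, X j vQ e
  /-- … is onto -/
  e_surjective : ∀ j vQ, Function.Surjective (e j vQ)
  /-- the normalized weight of the summand `v⃗` (Rmk. 3.1.1 (ii), third display) -/
  w : ∀ j vQ, E j vQ → ℝ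
  /-- … is nonnegative -/
  w_nonneg : ∀ j vQ e, 0 ≤ w j vQ e

attribute [instance] SummandPieces.instFintype

namespace SummandPieces

variable {L : LogShells T} (V : SummandPieces L)

/-- **`𝕄(𝓘^ℚ(^{S^±_{j+1}};𝒟^⊢_{v_ℚ}))`, VERBATIM**: a region of the packet is admissible iff its image in `Π_{v⃗} M_{v⃗}` is a
"direct product region" — "a direct product of compact subsets of positive measure in each of the direct
summands" ([IUTchIII] Rmk. 3.1.1 (iii), p. 95 l. 28–30; abc-iut-L6-t4 `IsDirectProductRegion`).
[claim: Mochizuki2012, status: disputed] -/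
@[claim "Mochizuki2012" "disputed"]
def Adm (j : T.Label) (vQ : T.VQ) (A : Set (L.Packet j vQ)) : Prop :=
  ∃ R : ∀ e, Set (V.X j vQ e), V.e j vQ '' A = Set.pi univ R ∧ ∀ e, V.adm j vQ e (R e)

/-- The `v⃗`-factor of (the image of) a region: its projection to the summand `M_{v⃗}`. [folklore] -/
def factor (j : T.Label) (vQ : T.VQ) (A : Set (L.Packet j vQ)) (e : V.E j vQ) : Set (V.X j vQ e) :=
  (fun y : ∀ e, V.X j vQ e => y e) '' (V.e j vQ '' A)

/-- **`μ^log_{S^±_{j+1},v_ℚ}`, VERBATIM on direct product regions**: the normalized weighted sum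
`Σ_{v⃗} w_{v⃗}·log μ_{v⃗}(A_{v⃗})` of the log-measures of the factors ([IUTchIII] Rmk. 3.1.1 (ii) p. 94, (iii) p. 96
l. 14–18; Prop. 3.9 (i) p. 115; the shape of abc-iut-L6-t4 `packetLogVolume`). On non-admissible regions a
junk value never read by the statement. [claim: Mochizuki2012, status: disputed] -/
def logvol (j : T.Label) (vQ : T.VQ) (A : Set (L.Packet j vQ)) : ℝ :=
  ∑ e, V.w j vQ e * V.logμ j vQ e (V.factor j vQ A e)

section OnePacket

variable {V} {j : T.Label} {vQ : T.VQ}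

/-- The factors of an admissible region are the sets it is the product of. [folklore] -/
theorem factor_eq_of_pi {A : Set (L.Packet j vQ)} {R : ∀ e, Set (V.X j vQ e)}
    (hA : V.e j vQ '' A = Set.pi univ R) (hne : ∀ e, (R e).Nonempty) (e : V.E j vQ) :
    V.factor j vQ A e = R e := by
  unfold factor
  rw [hA]
  exact Set.eval_image_univ_pi (Set.univ_pi_nonempty_iff.2 hne)

/-- An admissible region is the preimage-product of its factors, which are admissible. [folklore] -/
theorem Adm.pi_factor {A : Set (L.Packet j vQ)} (hA : V.Adm j vQ A) :
    V.e j vQ '' A = Set.pi univ (V.factor j vQ A) ∧ ∀ e, V.adm j vQ e (V.factor j vQ A e) := by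
  obtain ⟨R, hR, hadm⟩ := hA
  have hfac : ∀ e, V.factor j vQ A e = R e :=
    factor_eq_of_pi hR fun e => V.adm_nonempty j vQ e _ (hadm e)
  refine ⟨?_, fun e => (hfac e).symm ▸ hadm e⟩
  rw [hR]
  exact congrArg _ (funext fun e => (hfac e).symm)

/-- The log-volume of an admissible region in terms of any product presentation. [folklore] -/
theorem logvol_eq_of_pi {A : Set (L.Packet j vQ)} {R : ∀ e, Set (V.X j vQ e)}
    (hA : V.e j vQ '' A = Set.pi univ R) (hadm : ∀ e, V.adm j vQ e (R e)) :
    V.logvol j vQ A = ∑ e, V.w j vQ e * V.logμ j vQ e (R e) := by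
  unfold logvol
  exact Finset.sum_congr rfl fun e _ => by
    rw [factor_eq_of_pi hA (fun e => V.adm_nonempty j vQ e _ (hadm e)) e]

/-- An admissible region is nonempty. [folklore] -/
theorem Adm.nonempty {A : Set (L.Packet j vQ)} (hA : V.Adm j vQ A) : A.Nonempty := by
  obtain ⟨R, hR, hadm⟩ := hA
  have h : (V.e j vQ '' A).Nonempty := by
    rw [hR]; exact Set.univ_pi_nonempty_iff.2 fun e => V.adm_nonempty j vQ e _ (hadm e)
  exact h.of_image

variable (V j vQ)

/-- **Hull-type regions are admissible**: the preimage under `e` of a product `Π_{v⃗} H_{v⃗}` of admissible subsets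
of the summands is admissible (`e` is onto) — the shape of the binder `hadm`/`hul_adm` of c312-7's assemblers
once hull-sets are products over the summands (`λ·𝒪 = Π_{v⃗} λ_{v⃗}·𝒪_{v⃗}`, [IUTchIII] Rmk. 3.9.5 (i)). [folklore] -/
theorem adm_preimage_pi {R : ∀ e, Set (V.X j vQ e)} (hR : ∀ e, V.adm j vQ e (R e)) :
    V.Adm j vQ (V.e j vQ ⁻¹' Set.pi univ R) :=
  ⟨R, Set.image_preimage_eq _ (V.e_surjective j vQ), hR⟩

/-- … with log-volume `Σ_{v⃗} w_{v⃗}·log μ_{v⃗}(H_{v⃗})`. [folklore] -/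
theorem logvol_preimage_pi {R : ∀ e, Set (V.X j vQ e)} (hR : ∀ e, V.adm j vQ e (R e)) :
    V.logvol j vQ (V.e j vQ ⁻¹' Set.pi univ R) = ∑ e, V.w j vQ e * V.logμ j vQ e (R e) :=
  logvol_eq_of_pi (Set.image_preimage_eq _ (V.e_surjective j vQ)) hR

end OnePacket

/-! ## 2. Invariance under automorphisms intertwined with summand-structured measure-preserving maps -/

section Invariance

variable {j : T.Label} {vQ : T.VQ}

/-- A self-map `Ψ` of `Π_{v⃗} M_{v⃗}` **PRESERVES THE CONTAINER** at `(j, v_ℚ)`: it is bijective and both `Ψ` and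
`Ψ⁻¹` carry every direct product region to a direct product region with the same weighted log-volume. The two
printed instances: (Ind2) — "products of the automorphisms on each of the summands" preserving Haar measure
(Dupuy–Hilado §4.9 and its footnote "the measure of sets are preserved under these maps"); (Ind1) — a
permutation `v⃗ ↦ v⃗∘σ⁻¹` of the summands with measure-preserving identifications `M_{v⃗} ≅ M_{v⃗∘σ⁻¹}` and
symmetric weights ([IUTchIII] Prop. 3.9 (i) p. 116 "invariant with respect to permutations of `A`"; DH §4.7).
[folklore] -/
structure PreservesRegions (V : SummandPieces L) (j : T.Label) (vQ : T.VQ)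
    (Ψ : (∀ e, V.X j vQ e) → ∀ e, V.X j vQ e) : Prop where
  /-- `Ψ` is a bijection -/
  bijective : Function.Bijective Ψ
  /-- `Ψ` maps direct product regions to direct product regions of the same weighted log-volume -/
  map_pi : ∀ R : ∀ e, Set (V.X j vQ e), (∀ e, V.adm j vQ e (R e)) →
    ∃ R' : ∀ e, Set (V.X j vQ e), Ψ '' Set.pi univ R = Set.pi univ R' ∧ (∀ e, V.adm j vQ e (R' e)) ∧
      ∑ e, V.w j vQ e * V.logμ j vQ e (R' e) = ∑ e, V.w j vQ e * V.logμ j vQ e (R e)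
  /-- so does `Ψ⁻¹` -/
  preimage_pi : ∀ R : ∀ e, Set (V.X j vQ e), (∀ e, V.adm j vQ e (R e)) →
    ∃ R' : ∀ e, Set (V.X j vQ e), Ψ ⁻¹' Set.pi univ R = Set.pi univ R' ∧ (∀ e, V.adm j vQ e (R' e)) ∧
      ∑ e, V.w j vQ e * V.logμ j vQ e (R' e) = ∑ e, V.w j vQ e * V.logμ j vQ e (R e)

namespace PreservesRegions

variable {V}
variable {Ψ Ψ' : (∀ e, V.X j vQ e) → ∀ e, V.X j vQ e}

/-- Container-preserving maps compose. [folklore] -/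
theorem comp (h' : V.PreservesRegions j vQ Ψ') (h : V.PreservesRegions j vQ Ψ) :
    V.PreservesRegions j vQ (Ψ' ∘ Ψ) := by
  refine ⟨h'.bijective.comp h.bijective, fun R hR => ?_, fun R hR => ?_⟩
  · obtain ⟨R₁, h₁, hadm₁, hvol₁⟩ := h.map_pi R hR
    obtain ⟨R₂, h₂, hadm₂, hvol₂⟩ := h'.map_pi R₁ hadm₁
    exact ⟨R₂, by rw [Set.image_comp, h₁, h₂], hadm₂, hvol₂.trans hvol₁⟩
  · obtain ⟨R₁, h₁, hadm₁, hvol₁⟩ := h'.preimage_pi R hR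
    obtain ⟨R₂, h₂, hadm₂, hvol₂⟩ := h.preimage_pi R₁ hadm₁
    exact ⟨R₂, by rw [Set.preimage_comp, h₁, h₂], hadm₂, hvol₂.trans hvol₁⟩

/-- **SUMMANDWISE maps** (the (Ind2) shape): `Ψ(y)_{v⃗} = ψ_{v⃗}(y_{v⃗})` with each `ψ_{v⃗}` a bijection of `M_{v⃗}`
carrying admissible sets to admissible sets of the same log-measure, in both directions, preserves the
container. [folklore] -/
theorem summandwise (ψ : ∀ e, V.X j vQ e ≃ V.X j vQ e)
    (hadm : ∀ e (R : Set (V.X j vQ e)), V.adm j vQ e (ψ e '' R) ↔ V.adm j vQ e R)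
    (hvol : ∀ e (R : Set (V.X j vQ e)), V.adm j vQ e R → V.logμ j vQ e (ψ e '' R) = V.logμ j vQ e R) :
    V.PreservesRegions j vQ (fun y e => ψ e (y e)) := by
  have hsymm_adm : ∀ e (R : Set (V.X j vQ e)), V.adm j vQ e ((ψ e).symm '' R) ↔ V.adm j vQ e R := by
    intro e R
    rw [← hadm e ((ψ e).symm '' R), Equiv.image_symm_image]
  refine ⟨(Equiv.piCongrRight ψ).bijective, fun R hR => ?_, fun R hR => ?_⟩
  · refine ⟨fun e => ψ e '' R e, ?_, fun e => (hadm e _).2 (hR e), ?_⟩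
    · exact Set.piMap_image_univ_pi (fun e => ⇑(ψ e)) R
    · exact Finset.sum_congr rfl fun e _ => by rw [hvol e _ (hR e)]
  · refine ⟨fun e => (ψ e).symm '' R e, ?_, fun e => (hsymm_adm e _).2 (hR e), ?_⟩
    · have : (fun (y : ∀ e, V.X j vQ e) e => ψ e (y e)) ⁻¹' Set.pi univ R =
          (fun (y : ∀ e, V.X j vQ e) e => (ψ e).symm (y e)) '' Set.pi univ R := by
        ext y
        simp only [Set.mem_preimage, Set.mem_univ_pi, Set.mem_image]
        constructor
        · intro hy
          exact ⟨fun e => ψ e (y e), hy, funext fun e => (ψ e).symm_apply_apply (y e)⟩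
        · rintro ⟨z, hz, rfl⟩ e
          simpa using hz e
      rw [this]
      exact Set.piMap_image_univ_pi (fun e => ⇑(ψ e).symm) R
    · refine Finset.sum_congr rfl fun e _ => ?_
      have h := hvol e ((ψ e).symm '' R e) ((hsymm_adm e _).2 (hR e))
      rw [Equiv.image_symm_image] at h
      rw [h]

end PreservesRegions

variable {V}

/-- Transport of an image along an intertwining relation `e ∘ Φ = Ψ ∘ e`. [folklore] -/
theorem image_image_of_semiconj {Φ : L.Packet j vQ → L.Packet j vQ} {Ψ : (∀ e, V.X j vQ e) → ∀ e, V.X j vQ e}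
    (h : ∀ x, V.e j vQ (Φ x) = Ψ (V.e j vQ x)) (A : Set (L.Packet j vQ)) :
    V.e j vQ '' (Φ '' A) = Ψ '' (V.e j vQ '' A) := by
  rw [Set.image_image, Set.image_image]
  exact Set.image_congr fun x _ => h x

/-- **Admissibility is invariant** under a packet automorphism `Φ` intertwined by `e` with a
container-preserving `Ψ` (`e ∘ Φ = Ψ ∘ e`). [folklore] -/
theorem adm_image_iff {Φ : L.Packet j vQ ≃ₗ[ℚ] L.Packet j vQ} {Ψ : (∀ e, V.X j vQ e) → ∀ e, V.X j vQ e}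
    (hΨ : V.PreservesRegions j vQ Ψ) (h : ∀ x, V.e j vQ (Φ x) = Ψ (V.e j vQ x)) (A : Set (L.Packet j vQ)) :
    V.Adm j vQ (Φ '' A) ↔ V.Adm j vQ A := by
  constructor
  · rintro ⟨R', hR', hadm'⟩
    obtain ⟨R, hR, hadm, -⟩ := hΨ.preimage_pi R' hadm'
    refine ⟨R, ?_, hadm⟩
    rw [← hR, ← hR', image_image_of_semiconj h, Set.preimage_image_eq _ hΨ.bijective.1]
  · rintro ⟨R, hR, hadm⟩
    obtain ⟨R', hR', hadm', -⟩ := hΨ.map_pi R hadm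
    exact ⟨R', by rw [image_image_of_semiconj h, hR, hR'], hadm'⟩

/-- **The log-volume is invariant** on admissible regions under such a `Φ`. [folklore] -/
theorem logvol_image_eq {Φ : L.Packet j vQ ≃ₗ[ℚ] L.Packet j vQ} {Ψ : (∀ e, V.X j vQ e) → ∀ e, V.X j vQ e}
    (hΨ : V.PreservesRegions j vQ Ψ) (h : ∀ x, V.e j vQ (Φ x) = Ψ (V.e j vQ x)) {A : Set (L.Packet j vQ)}
    (hA : V.Adm j vQ A) : V.logvol j vQ (Φ '' A) = V.logvol j vQ A := by
  obtain ⟨R, hR, hadm⟩ := hA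
  obtain ⟨R', hR', hadm', hvol⟩ := hΨ.map_pi R hadm
  have hΦA : V.e j vQ '' (Φ '' A) = Set.pi univ R' := by rw [image_image_of_semiconj h, hR, hR']
  rw [logvol_eq_of_pi hΦA hadm', logvol_eq_of_pi hR hadm, hvol]

end Invariance

/-! ### The line data carry these volumes; invariance along (Ind1), (Ind2) -/

/-- The `MRData` `D` of one vertical line CARRIES the verbatim volumes of `V` (pointwise; `Iff.rfl`/`rfl` for
c312-5's `MRData.ofShells … V.Adm V.logvol …`, `realizes_ofShells`). [folklore] -/
@[folklore]
structure Realizes (V : SummandPieces L) (D : MRData L) : Prop where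
  /-- the admissible regions are `V.Adm` -/
  adm_iff : ∀ (j : T.Label) (vQ : T.VQ) (A : Set (L.Packet j vQ)), D.Adm j vQ A ↔ V.Adm j vQ A
  /-- the log-volume is `V.logvol` -/
  logvol_eq : ∀ (j : T.Label) (vQ : T.VQ) (A : Set (L.Packet j vQ)), D.logvol j vQ A = V.logvol j vQ A

/-- The line data of c312-5's `MRData.ofShells` with `Adm := V.Adm`, `logvol := V.logvol` realizes `V`. [folklore] -/
theorem realizes_ofShells (V : SummandPieces L)
    (archPk : ∀ (j : T.Label) (vQ : T.VQ), Set (L.Packet j vQ))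
    (archSub : ∀ (j : T.Label) (v : T.V), Set (L.Packet j (T.over v)))
    (Ψ : ∀ v : T.V, v ∈ T.Vbad → Set (L.StarPacket v))
    (act : ∀ v : T.V, v ∈ T.Vbad → L.StarPacket v → Module.End ℚ (L.StarPacket v))
    (Mmod : ∀ j : T.LabelStar, Set (L.GlobalPacket j.1)) :
    V.Realizes (MRData.ofShells L archPk archSub V.Adm V.logvol Ψ act Mmod) :=
  ⟨fun _ _ _ => Iff.rfl, fun _ _ _ => rfl⟩

/-- **Monotonicity on admissible regions** for line data realizing the container ([IUTchIII] Prop. 3.9 (i);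
c312-6's `LogvolMono`/`BridgeHyps.mono`): nonnegative weights, factorwise monotone log-measures. [folklore] -/
theorem logvol_mono_of_realizes {D : MRData L} (hD : V.Realizes D) {j : T.Label} {vQ : T.VQ}
    {A B : Set (L.Packet j vQ)} (hA : D.Adm j vQ A) (hB : D.Adm j vQ B) (hAB : A ⊆ B) :
    D.logvol j vQ A ≤ D.logvol j vQ B := by
  rw [hD.logvol_eq, hD.logvol_eq]
  obtain ⟨hpA, hadmA⟩ := Adm.pi_factor ((hD.adm_iff j vQ A).1 hA)
  obtain ⟨hpB, hadmB⟩ := Adm.pi_factor ((hD.adm_iff j vQ B).1 hB)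
  have hsub : Set.pi univ (V.factor j vQ A) ⊆ Set.pi univ (V.factor j vQ B) := by
    rw [← hpA, ← hpB]; exact Set.image_mono hAB
  have hfac : ∀ e, V.factor j vQ A e ⊆ V.factor j vQ B e := by
    rcases Set.univ_pi_subset_univ_pi_iff.mp hsub with h | ⟨e, he⟩
    · exact h
    · exact absurd he (V.adm_nonempty j vQ e _ (hadmA e)).ne_empty
  exact Finset.sum_le_sum fun e _ =>
    mul_le_mul_of_nonneg_left (V.logμ_mono j vQ e _ _ (hadmA e) (hadmB e) (hfac e)) (V.w_nonneg j vQ e)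

section Generators

variable {V} {D : MRData L}

/-- **The generator hypotheses** (bundled): every capsule permutation `permute σ`, every factor-and-summand-wise
family of strip-automorphisms and every such family of `Ism`-elements (c312-1's generators of (Ind1), (Ind2)) is
intertwined by the comparison `e` with a container-preserving self-map of `Π_{v⃗} M_{v⃗}`. PROVED for the real prime
packets in the companion `Cor312VolumesPadicSummands`; a HYPOTHESIS structure here. [folklore] -/
@[folklore]
structure GeneratorsPreserve (V : SummandPieces L) : Prop where
  /-- (Ind1), permutation part -/
  perm : ∀ (j : T.Label) (vQ : T.VQ) (σ : Equiv.Perm (T.Caps j)),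
    ∃ Ψ, V.PreservesRegions j vQ Ψ ∧ ∀ x, V.e j vQ (L.permute j vQ σ x) = Ψ (V.e j vQ x)
  /-- (Ind1), strip-automorphism part -/
  strip : ∀ (j : T.Label) (vQ : T.VQ) (g : T.Caps j → ∀ v : T.Fibre vQ, L.carrier v.1 ≃ₗ[ℚ] L.carrier v.1),
    (∀ i v, g i v ∈ L.stripAut v.1) → ∃ Ψ, V.PreservesRegions j vQ Ψ ∧
      ∀ x, V.e j vQ (L.factorwise j vQ (fun i => L.summandwise vQ (g i)) x) = Ψ (V.e j vQ x)
  /-- (Ind2) -/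
  ism : ∀ (j : T.Label) (vQ : T.VQ) (g : T.Caps j → ∀ v : T.Fibre vQ, L.carrier v.1 ≃ₗ[ℚ] L.carrier v.1),
    (∀ i v, g i v ∈ L.ism v.1) → ∃ Ψ, V.PreservesRegions j vQ Ψ ∧
      ∀ x, V.e j vQ (L.factorwise j vQ (fun i => L.summandwise vQ (g i)) x) = Ψ (V.e j vQ x)

/-- Under the generator hypotheses EVERY (Ind1)- or (Ind2)-family is intertwined, at every `(j, v_ℚ)`, with a
container-preserving map (an (Ind1)-family is `permute σ` followed by a strip family). [folklore] -/
theorem GeneratorsPreserve.family (hG : V.GeneratorsPreserve) {Φ : L.PacketAut}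
    (hΦ : Φ ∈ L.Ind1Family ∨ Φ ∈ L.Ind2Family) (j : T.Label) (vQ : T.VQ) :
    ∃ Ψ, V.PreservesRegions j vQ Ψ ∧ ∀ x, V.e j vQ (Φ j vQ x) = Ψ (V.e j vQ x) := by
  rcases hΦ with hΦ | hΦ
  · obtain ⟨σ, h, hh, hΦj⟩ := hΦ j
    obtain ⟨ΨP, hΨP, hcommP⟩ := hG.perm j vQ σ
    obtain ⟨ΨS, hΨS, hcommS⟩ := hG.strip j vQ (fun i v => h i v.1) fun i v => hh i v.1
    refine ⟨ΨS ∘ ΨP, hΨS.comp hΨP, fun x => ?_⟩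
    have hΦj' : Φ j vQ = (L.permute j vQ σ).trans
        (L.factorwise j vQ fun i => L.summandwise vQ fun v => h i v.1) := hΦj vQ
    have hx : Φ j vQ x = L.factorwise j vQ (fun i => L.summandwise vQ fun v => h i v.1)
        (L.permute j vQ σ x) := by
      rw [hΦj']; rfl
    rw [hx, hcommS, hcommP]
    rfl
  · obtain ⟨g, hg, hΦj⟩ := hΦ j vQ
    obtain ⟨Ψ, hΨ, hcomm⟩ := hG.ism j vQ g hg
    exact ⟨Ψ, hΨ, fun x => by rw [hΦj]; exact hcomm x⟩

/-- **Admissibility transport and B's `LogvolInvariant` from the generators of (Ind1), (Ind2)**: for line data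
realizing `V`, every (Ind1)- or (Ind2)-family carries admissible regions to admissible regions (both ways) and
preserves their log-volume — the two hypotheses of abc-iut-L6-t13's propagation theorem, the second being B's
named Prop `MRData.LogvolInvariant` ([IUTchIII] proof of Cor. 3.12, Step (x), p. 181: "invariant with respect to
the indeterminacies (Ind1), (Ind2)"). [folklore] -/
theorem adm_iff_and_logvolInvariant_of_generators (hD : V.Realizes D) (hG : V.GeneratorsPreserve) :
    (∀ Φ ∈ L.Ind1Family ∪ L.Ind2Family, ∀ (j : T.Label) (vQ : T.VQ) (A : Set (L.Packet j vQ)),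
      D.Adm j vQ A ↔ D.Adm j vQ (Φ j vQ '' A)) ∧ D.LogvolInvariant := by
  refine ⟨fun Φ hΦ j vQ A => ?_, fun Φ hΦ j vQ A hA => ?_⟩
  · obtain ⟨Ψ, hΨ, hcomm⟩ := hG.family ((Set.mem_union _ _ _).1 hΦ) j vQ
    rw [hD.adm_iff, hD.adm_iff, adm_image_iff hΨ hcomm]
  · obtain ⟨Ψ, hΨ, hcomm⟩ := hG.family hΦ j vQ
    rw [hD.logvol_eq, hD.logvol_eq]
    exact logvol_image_eq hΨ hcomm ((hD.adm_iff j vQ A).1 hA)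

/-- **Invariance along the whole indeterminacy subgroup** `⟨Ind1Family ∪ Ind2Family⟩` (c312-7's
`Setting.indGroup`, c312-1's `LogShells.IndGroup`): every element carries admissible regions to admissible
regions OF THE SAME LOG-VOLUME (abc-iut-L6-t13's `adm_and_logvol_eq_of_mem_closure`, both hypotheses discharged
for this container). [folklore] -/
theorem adm_and_logvol_eq_of_mem_indGroup (hD : V.Realizes D) (hG : V.GeneratorsPreserve)
    {Φ : L.PacketAut} (hΦ : Φ ∈ Subgroup.closure (L.Ind1Family ∪ L.Ind2Family))
    (j : T.Label) (vQ : T.VQ) (A : Set (L.Packet j vQ)) (hA : D.Adm j vQ A) :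
    D.Adm j vQ (Φ j vQ '' A) ∧ D.logvol j vQ (Φ j vQ '' A) = D.logvol j vQ A :=
  have h := adm_iff_and_logvolInvariant_of_generators hD hG
  D.adm_and_logvol_eq_of_mem_closure h.1 h.2 hΦ j vQ A hA

end Generators

end SummandPieces

end Cor312Vol

end IUTFork

end Summit.ABC

end
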